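import Summits.CriticalPhenomena.PercolationContinuityZ3.Theorems.PercNearOneGluingNoHeavyQuantBlobWalk
import Summits.CriticalPhenomena.PercolationContinuityZ3.Theorems.PercNearOneGluingNoHeavyQuantFarTreeRowContraction
import Summits.CriticalPhenomena.PercolationContinuityZ3.Theorems.PercNearOneGluingNoHeavyQuantHalfMeanSmallBall
import HarnessLib

/-!
# QUANT lane R8 tool: the blob-walk recursion `CB[a, p, m]` IS the cdf of the open blob mass under `prodBernoulli`
# (canonical model), and the iid block-star inequality for the equal-gate route from `Quant.halfMean_smallBall`

builds on p205010 (kernel theorem, internal audit signed; external expert review pending)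

Support file (`--supports stmt-CriticalPhenomena-4575`), QUANT lane lead (gen 10); companion of `…QuantBlobWalk.lean`
(paper: `run/shared/lean/prim/quant/prim-quant-lead-g10/LEAD-NOTES-G10.md` N21 (3)).  Theorems only; no sorries; standard axioms.

* `Quant.BlobWalk.CB_eq_prodBernoulli` — for gates `p k ∈ [0,1]` and the canonical model on `Fin M` (coordinate `i` open with
  probability `p i`), `CB[a, p, m] t = P(Σ_{i < m, i open} a i ≤ t)` for `m ≤ M` (induction on `m` by conditioning on gate `m`,
  `Quant.prodBernoulli_real_gate_split` + `prodBernoulli_real_update_one_eq/_zero_eq`).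
* `Quant.BlobWalk.blockStar_const` — **the iid block-star inequality** needed by `Quant.BlobWalk.exchange_of_const`:
  for a constant gate `g ∈ [0,1]`, sizes `a`, terminal size `c` and `2j < g·(Σ_{k<K} a k + c)`,
  `g · CB[a, g, K] (j − c) ≤ (1 − g) · (1 − CB[a, g, K] j)` — `Quant.halfMean_smallBall` (p2 g20's FAR for independent blobs) applied
  to the `K` blobs plus the terminal blob as a `(K+1)`-st coordinate, split on that coordinate.
* `Quant.BlobWalk.exchange_of_const'` — the equal-gate route with the block-star hypothesis DISCHARGED: constant private gates
  `g ∈ (0,1]`, chain weights with `x ≤ w k · g`, `x ≥ 0`, and `2j < g (A + c)` give the FAR exchange inequality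
  `x · CB[K](j − c) ≤ Σ_{k<K} (w k − x) g (CB[k] j − CB[k] (j − a k))`.  With the tree-side identity (N21 (1), `Quant.spine_identity`)
  this is FAR at every layer for block-combs with equal private gates.
[this work]; product measure / conditioning on one gate [cite: Grimmett1999, §1.3 p. 10; §2.4].
-/

noncomputable section

namespace Summit.CriticalPhenomena.PercolationContinuityZ3.Theorems

namespace Quant

namespace BlobWalk

open Finset MeasureTheory
open Literature.Probability.LatticeModels
open Literature.Probability.Percolation
open scoped Classical

/-- `CB[a, p, m] t` (see `…QuantBlobWalk.lean`). -/
local notation3 "CB[" a ", " p ", " m "]" =>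
  (Nat.rec (motive := fun _ => ℤ → ℝ) (fun t => if (0 : ℤ) ≤ t then (1 : ℝ) else 0)
    (fun n f t => (p : ℕ → ℝ) n * f (t - ((a : ℕ → ℕ) n : ℤ)) + (1 - (p : ℕ → ℝ) n) * f t) (m : ℕ))

/-- The open mass of the coordinates below `m` in the canonical model on `Fin M`. -/
local notation3 "MASS[" a ", " M ", " m "]" =>
  (fun ω : Set (Fin (M : ℕ)) => ∑ i ∈ (Finset.univ : Finset (Fin M)).filter (fun i => i.val < (m : ℕ) ∧ i ∈ ω), (((a : ℕ → ℕ) i.val : ℕ) : ℤ))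

variable (a : ℕ → ℕ)

/-- Inserting coordinate `m` adds `a m` to the mass below `m+1` and leaves the mass below `m` alone
(stated for a generic `S = insert ⟨m,_⟩ ω` so that the classical decidability instances match at use sites). -/
theorem mass_insert (M m : ℕ) (hm : m < M) (S ω : Set (Fin M)) (hS : S = insert (⟨m, hm⟩ : Fin M) ω) :
    (∑ i ∈ (Finset.univ : Finset (Fin M)).filter (fun i => i.val < m + 1 ∧ i ∈ S), ((a i.val : ℕ) : ℤ)) =
      (a m : ℤ) + ∑ i ∈ (Finset.univ : Finset (Fin M)).filter (fun i => i.val < m ∧ i ∈ ω), ((a i.val : ℕ) : ℤ) := by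
  subst hS
  set e : Fin M := ⟨m, hm⟩ with he
  rw [Finset.sum_filter, Finset.sum_filter, ← Finset.add_sum_erase _ _ (Finset.mem_univ e),
    ← Finset.add_sum_erase (Finset.univ : Finset (Fin M)) _ (Finset.mem_univ e)]
  have hPe : e.val < m + 1 ∧ e ∈ insert e ω := ⟨by simp [he], Set.mem_insert _ _⟩
  have hQe : ¬ (e.val < m ∧ e ∈ ω) := fun h => by simp [he] at h
  rw [if_pos hPe, if_neg hQe, zero_add]
  have hae : ((a e.val : ℕ) : ℤ) = (a m : ℤ) := by simp [he]
  rw [hae]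
  congr 1
  refine Finset.sum_congr rfl fun i hi => ?_
  have hne : i ≠ e := Finset.ne_of_mem_erase hi
  have hval : i.val ≠ m := fun h => hne (Fin.ext (by rw [he]; exact h))
  by_cases hq : i.val < m ∧ i ∈ ω
  · rw [if_pos hq, if_pos ⟨by omega, Set.mem_insert_of_mem _ hq.2⟩]
  · rw [if_neg hq, if_neg]
    rintro ⟨h1, h2⟩
    rcases Set.mem_insert_iff.1 h2 with h | h
    · exact hne h
    · exact hq ⟨by omega, h⟩

/-- Removing coordinate `m` from `ω` makes the mass below `m+1` equal to the mass below `m` (generic `S = ω ∖ {⟨m,_⟩}`). -/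
theorem mass_diff (M m : ℕ) (hm : m < M) (S ω : Set (Fin M)) (hS : S = ω \ {(⟨m, hm⟩ : Fin M)}) :
    (∑ i ∈ (Finset.univ : Finset (Fin M)).filter (fun i => i.val < m + 1 ∧ i ∈ S), ((a i.val : ℕ) : ℤ)) =
      ∑ i ∈ (Finset.univ : Finset (Fin M)).filter (fun i => i.val < m ∧ i ∈ ω), ((a i.val : ℕ) : ℤ) := by
  subst hS
  set e : Fin M := ⟨m, hm⟩ with he
  rw [Finset.sum_filter, Finset.sum_filter]
  refine Finset.sum_congr rfl fun i _ => ?_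
  by_cases hq : i.val < m ∧ i ∈ ω
  · have hne : i ≠ e := fun h => by rw [h, he] at hq; simp at hq
    rw [if_pos hq, if_pos ⟨by omega, Set.mem_sdiff_singleton.2 ⟨hq.2, hne⟩⟩]
  · rw [if_neg hq, if_neg]
    rintro ⟨h1, h2⟩
    rcases Set.mem_sdiff_singleton.1 h2 with ⟨h3, h4⟩
    have hval : i.val ≠ m := fun h => h4 (Fin.ext (by rw [he]; exact h))
    exact hq ⟨by omega, h3⟩

/-- No coordinates below `0`: the mass is `0`. -/
theorem mass_zero (M : ℕ) (ω : Set (Fin M)) :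
    (∑ i ∈ (Finset.univ : Finset (Fin M)).filter (fun i => i.val < 0 ∧ i ∈ ω), ((a i.val : ℕ) : ℤ)) = 0 := by
  rw [Finset.sum_filter]
  refine Finset.sum_eq_zero fun i _ => ?_
  rw [if_neg]
  exact fun h => (Nat.not_lt_zero _ h.1)

/-- **Canonical model.**  For gates `p k ∈ [0,1]`, `m ≤ M` and every `t : ℤ`, `CB[a, p, m] t` is the `prodBernoulli`-probability
(coordinate `i : Fin M` open with probability `p i`) that the open mass of the coordinates below `m` is `≤ t`. [this work] -/
theorem CB_eq_prodBernoulli (p : ℕ → ℝ) (hp : ∀ k, 0 ≤ p k ∧ p k ≤ 1) (M : ℕ) :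
    ∀ m, m ≤ M → ∀ t : ℤ, CB[a, p, m] t =
      (prodBernoulli (fun i : Fin M => (⟨p i, (hp i).1, (hp i).2⟩ : unitInterval))).real
        {ω : Set (Fin M) | MASS[a, M, m] ω ≤ t} := by
  set pp : Fin M → unitInterval := fun i => ⟨p i, (hp i).1, (hp i).2⟩ with hpp
  intro m
  induction m with
  | zero =>
    intro _ t
    have hev : {ω : Set (Fin M) | MASS[a, M, 0] ω ≤ t} = if (0 : ℤ) ≤ t then Set.univ else ∅ := by
      ext ω
      have h0 := mass_zero a M ω
      simp only [Set.mem_setOf_eq]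
      rw [h0]
      split_ifs with h <;> simp [h]
    rw [hev]
    show (if (0 : ℤ) ≤ t then (1 : ℝ) else 0) = _
    split_ifs <;> simp
  | succ m ih =>
    intro hm t
    have hmM : m < M := by omega
    set B : Set (Set (Fin M)) := {ω : Set (Fin M) | MASS[a, M, m + 1] ω ≤ t} with hB
    have hdet : DeterminedBy B (↑(Finset.univ : Finset (Fin M)) : Set (Fin M)) := by
      rw [determinedBy_iff]
      intro ω ω' h
      simp only [Finset.coe_univ, Set.inter_univ] at h
      rw [h]
    have hsplit := prodBernoulli_real_gate_split pp (⟨m, hmM⟩ : Fin M) B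
    rw [prodBernoulli_real_update_one_eq hdet pp (Finset.mem_univ _),
      prodBernoulli_real_update_zero_eq hdet pp (Finset.mem_univ _)] at hsplit
    have h1 : {ω : Set (Fin M) | insert (⟨m, hmM⟩ : Fin M) ω ∈ B} =
        {ω : Set (Fin M) | MASS[a, M, m] ω ≤ t - (a m : ℤ)} := by
      ext ω
      simp only [Set.mem_setOf_eq, hB]
      rw [mass_insert a M m hmM _ ω rfl]
      constructor <;> intro h <;> linarith
    have h0 : {ω : Set (Fin M) | ω \ {(⟨m, hmM⟩ : Fin M)} ∈ B} = {ω : Set (Fin M) | MASS[a, M, m] ω ≤ t} := by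
      ext ω
      simp only [Set.mem_setOf_eq, hB]
      rw [mass_diff a M m hmM _ ω rfl]
    have hpe : (pp ⟨m, hmM⟩ : ℝ) = p m := by simp [hpp]
    show p m * CB[a, p, m] (t - (a m : ℤ)) + (1 - p m) * CB[a, p, m] t = (prodBernoulli pp).real B
    rw [hsplit, h1, h0, hpe, ih (by omega) (t - (a m : ℤ)), ih (by omega) t]

/-- **The iid block-star inequality** (`Quant.halfMean_smallBall` specialised): constant gate `g ∈ [0,1]`, sizes `a`, terminal size
`c`, `2j < g · (Σ_{k<K} a k + c)` ⟹ `g · CB[a, g, K] (j − c) ≤ (1 − g) · (1 − CB[a, g, K] j)`.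
(The `K+1` independent blobs `(a 0, g), …, (a (K−1), g), (c, g)`: `P(mass ≤ j) ≤ 1 − g`, split on the terminal blob.) [this work] -/
theorem blockStar_const (g : ℝ) (hg0 : 0 ≤ g) (hg1 : g ≤ 1) (K : ℕ) (c j : ℕ)
    (hmean : (2 * j : ℝ) < g * (((∑ k ∈ Finset.range K, a k : ℕ) : ℝ) + c)) :
    g * CB[a, (fun _ => g), K] ((j : ℤ) - (c : ℤ)) ≤ (1 - g) * (1 - CB[a, (fun _ => g), K] (j : ℤ)) := by
  -- sizes with the terminal blob appended as coordinate `K` of `Fin (K+1)`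
  set a' : ℕ → ℕ := fun k => if k < K then a k else c with ha'
  have hp : ∀ k : ℕ, 0 ≤ (fun _ : ℕ => g) k ∧ (fun _ : ℕ => g) k ≤ 1 := fun _ => ⟨hg0, hg1⟩
  set pp : Fin (K + 1) → unitInterval := fun _ => ⟨g, hg0, hg1⟩ with hpp
  -- `CB[a, g, K] = CB[a', g, K]` (the first `K` sizes agree)
  have hCB : ∀ m, m ≤ K → ∀ t : ℤ, CB[a, (fun _ => g), m] t = CB[a', (fun _ => g), m] t := by
    intro m
    induction m with
    | zero => intro _ t; rfl
    | succ m ih =>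
      intro hm t
      have hlt : m < K := by omega
      show g * CB[a, (fun _ => g), m] (t - (a m : ℤ)) + (1 - g) * CB[a, (fun _ => g), m] t =
        g * CB[a', (fun _ => g), m] (t - (a' m : ℤ)) + (1 - g) * CB[a', (fun _ => g), m] t
      have : a' m = a m := by simp [ha', hlt]
      rw [this, ih (by omega), ih (by omega)]
  -- `halfMean_smallBall` on `Fin (K+1)` with sizes `a' ∘ val`
  have hsum : ∑ i : Fin (K + 1), ((a' i.val : ℕ) : ℝ) * (pp i : ℝ) = g * (((∑ k ∈ Finset.range K, a k : ℕ) : ℝ) + c) := by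
    have e1 : ∑ i : Fin (K + 1), ((a' i.val : ℕ) : ℝ) * (pp i : ℝ) = g * ∑ i : Fin (K + 1), ((a' i.val : ℕ) : ℝ) := by
      rw [Finset.mul_sum]; exact Finset.sum_congr rfl fun i _ => by simp [hpp]; ring
    rw [e1, Fin.sum_univ_castSucc]
    congr 1
    have e2 : ∑ i : Fin K, ((a' (Fin.castSucc i).val : ℕ) : ℝ) = ((∑ k ∈ Finset.range K, a k : ℕ) : ℝ) := by
      rw [Nat.cast_sum, ← Fin.sum_univ_eq_sum_range (fun k => (a k : ℝ))]
      exact Finset.sum_congr rfl fun i _ => by simp [ha', i.isLt]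
    have e3 : ((a' (Fin.last K).val : ℕ) : ℝ) = c := by simp [ha']
    rw [e2, e3]
  have hmean' : (2 * j : ℝ) < ∑ i : Fin (K + 1), ((a' i.val : ℕ) : ℝ) * (pp i : ℝ) := by rw [hsum]; exact hmean
  have ht : ∀ i : Fin (K + 1), 1 - (pp i : ℝ) ≤ 1 - g := fun i => by simp [hpp]
  have hmain := halfMean_smallBall pp (fun i => a' i.val) j (1 - g) hmean' ht
  -- identify the light event's probability with `g·CB[a',K](j−c) + (1−g)·CB[a',K](j)`
  set E : Set (Set (Fin (K + 1))) :=
    {s : Set (Fin (K + 1)) | ∑ i ∈ Finset.univ.filter (fun i => i ∈ s), a' i.val ≤ j} with hE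
  set B : Set (Set (Fin (K + 1))) := {ω : Set (Fin (K + 1)) | MASS[a', K + 1, K + 1] ω ≤ (j : ℤ)} with hB
  have hEB : E = B := by
    ext s
    simp only [hE, hB, Set.mem_setOf_eq]
    have hf : (Finset.univ : Finset (Fin (K + 1))).filter (fun i => i.val < K + 1 ∧ i ∈ s) =
        Finset.univ.filter (fun i => i ∈ s) := by
      ext i; simp only [Finset.mem_filter, Finset.mem_univ, true_and]; exact ⟨fun h => h.2, fun h => ⟨i.isLt, h⟩⟩
    rw [hf]
    constructor <;> intro h <;> exact_mod_cast h
  have hKK : K < K + 1 := Nat.lt_succ_self K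
  have hdet : DeterminedBy B (↑(Finset.univ : Finset (Fin (K + 1))) : Set (Fin (K + 1))) := by
    rw [determinedBy_iff]
    intro ω ω' h
    simp only [Finset.coe_univ, Set.inter_univ] at h
    rw [h]
  have hsplit := prodBernoulli_real_gate_split pp (⟨K, hKK⟩ : Fin (K + 1)) B
  rw [prodBernoulli_real_update_one_eq hdet pp (Finset.mem_univ _),
    prodBernoulli_real_update_zero_eq hdet pp (Finset.mem_univ _)] at hsplit
  have h1 : {ω : Set (Fin (K + 1)) | insert (⟨K, hKK⟩ : Fin (K + 1)) ω ∈ B} =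
      {ω : Set (Fin (K + 1)) | MASS[a', K + 1, K] ω ≤ (j : ℤ) - (c : ℤ)} := by
    ext ω
    simp only [Set.mem_setOf_eq, hB]
    rw [mass_insert a' (K + 1) K hKK _ ω rfl]
    have : ((a' K : ℕ) : ℤ) = c := by simp [ha']
    rw [this]
    constructor <;> intro h <;> linarith
  have h0 : {ω : Set (Fin (K + 1)) | ω \ {(⟨K, hKK⟩ : Fin (K + 1))} ∈ B} =
      {ω : Set (Fin (K + 1)) | MASS[a', K + 1, K] ω ≤ (j : ℤ)} := by
    ext ω
    simp only [Set.mem_setOf_eq, hB]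
    rw [mass_diff a' (K + 1) K hKK _ ω rfl]
  have hpe : (pp ⟨K, hKK⟩ : ℝ) = g := by simp [hpp]
  have hmodel := CB_eq_prodBernoulli a' (fun _ => g) hp (K + 1) K (by omega)
  have hppdef : (fun i : Fin (K + 1) => (⟨(fun _ : ℕ => g) i.val, (hp i.val).1, (hp i.val).2⟩ : unitInterval)) = pp := by
    funext i; rfl
  rw [hppdef] at hmodel
  rw [hEB, hsplit, h1, h0, hpe, ← hmodel ((j : ℤ) - (c : ℤ)), ← hmodel (j : ℤ)] at hmain
  rw [hCB K le_rfl, hCB K le_rfl]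
  linarith

/-- **Equal-gate route, block-star hypothesis discharged.**  Constant private gates `g ∈ (0,1]`, chain weights with `x ≤ w k · g`
(`k < K`), `x ≥ 0`, and the budget `2j < g · (A + c)` give the FAR exchange inequality
`x · CB[K](j − c) ≤ Σ_{k<K} (w k − x) · g · (CB[k] j − CB[k](j − a k))` for the block-comb's blob walk.  Together with the tree-side
identity `P(N ≥ j+1) − x = Σ_k (w k − x) g (CB[k] j − CB[k] (j − a k)) − x CB[K](j − c)` (`Quant.spine_identity` + Abel) this is FAR at
EVERY layer for block-combs with equal private gates. [this work] -/
theorem exchange_of_const' (g : ℝ) (hg0 : 0 < g) (hg1 : g ≤ 1) (K : ℕ) (j c : ℕ) (x : ℝ)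
    (w : ℕ → ℝ) (hx : 0 ≤ x) (hwx : ∀ k, k < K → x ≤ w k * g)
    (hmean : (2 * j : ℝ) < g * (((∑ k ∈ Finset.range K, a k : ℕ) : ℝ) + c)) :
    x * CB[a, (fun _ => g), K] ((j : ℤ) - (c : ℤ)) ≤
      ∑ k ∈ Finset.range K, (w k - x) * g * (CB[a, (fun _ => g), k] (j : ℤ) - CB[a, (fun _ => g), k] ((j : ℤ) - (a k : ℤ))) := by
  have hBS := blockStar_const a g hg0.le hg1 K c j hmean
  have hj : (0 : ℤ) ≤ (j : ℤ) := Int.natCast_nonneg j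
  exact exchange_of_const a g hg0 hg1 K (j : ℤ) hj c x w hx hwx hBS

end BlobWalk

end Quant

end Summit.CriticalPhenomena.PercolationContinuityZ3.Theorems

end
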